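import Summits.ABC.IUTFork.Repair.RHCellWeightsCreditScreenDatum
import HarnessLib

/-!
# R-H ROUND 3, THE OTHER DIRECTION: a CERTIFIED `θ·j²` credit above the slice DISCHARGES the weighted [MU-C] at `μ₀ = (S(J) + θ·(S(l⋇) − S(J)))/S(l⋇)`,
# and the SUP-FORM of screen rule S1 for place-dependent slices (`Φ_v ≤ Φ` at every bad packet ⟹ kept mass `≤ Φ·M`)

abc-iut cell, rung LADDER-ABC:A2.RESCUE.H; R-H seat abc-iut-rh2-w-1 (GEN 2; Q1′ WEIGHTS typer, kernel side); companion of `Repair/RHCellWeightsCreditScreen{,Datum,Sharp}.lean`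
(p485470 / p485917 / p486517: the NECESSITY direction — what a credit profile can keep AT MOST). PROOF-ONLY (0 definitions, 0 `Prop` facts). This file adds:
* §1 the SUFFICIENCY direction (the weighted analogue of p483646's depth certificate): one packet, `ω` with FULL credit below the slice (`ω_i = 1` for `i+1 ≤ J`,
  i.e. licence there) and a CERTIFIED fraction `θ ≥ 0` of each cell's demand above it (`θ·((i+1)²−1) ≤ ω_i·((i+1)²−1)` for `i+1 > J`) keeps AT LEAST
  `(S(J) + θ·(S(n) − S(J)))·h` (`placeSum_credit_ge_of_quadratic`); at the bed with uniform `J, θ` at every packet of non-zero place weight the ω-KEPT MASS is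
  `≥ ((S(J) + θ·(S(l⋇) − S(J)))/S(l⋇))·M` (`keptMass_settingPrVolSharp_ge_frac_mul_totalTrivialMass_of_quadraticCredit`), hence at a genuine datum (chosen ideles,
  `M = T.gap`) **the weighted [MU-C] `OffSigmaTolerance (1 − μ₀) A T (weightedTrivialMass … ω)` HOLDS for `μ₀ := (S(J) + θ·(S(l⋇) − S(J)))/S(l⋇)` and every `A ≥ 0`**
  (`offSigmaTolerance_weightedTrivialMass_of_quadraticCredit_chosen`) — abc-iut-rh2-q2-eq's partial-credit door (`RHSigmaCellCredit`, p484504) then carries such a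
  candidate to the EXP endpoints with exponent `1/μ₀ = 1/(f³ + θ(1 − f³))` (reading; `θ = 1` ⟹ `μ₀ = 1`, the licence; `θ = 0` ⟹ p483646's depth certificate);
* §2 the SUP-FORM of S1 for PLACE-DEPENDENT slices `J(v_ℚ)` and coefficients: if at every packet of non-zero place weight the per-place kept numerator is
  `≤ Φ·S(l⋇)` (`S(J(v_ℚ)) + a(v_ℚ)·T(l⋇) + b(v_ℚ)·l⋇ ≤ Φ·S(l⋇)`), then `K(ω) ≤ Φ·M` (`keptMass_settingPrVolSharp_le_sup_mul_totalTrivialMass`) and, at the datum,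
  the weighted [MU-C] forces `μ₀·T.gap ≤ Φ·T.gap + A` (`mu_mul_gap_le_sup_of_offSigmaTolerance_weightedTrivialMass_chosen`) — the form the rh4 testers use with
  `Φ := max_v Φ_v` over a datum's bad places (SLICE.md's `j₀(w)` per place).
HONEST FRAMING: arithmetic about OUR typed weights at the genuine bed; `ω` (a candidate's credit) and every [MU-C] are HYPOTHESIS SHAPES — §1 says what a CERTIFIED
credit law would buy AS TYPED, it certifies no credit for any object; nothing here asserts that abc is proved or refuted, or that [IUTchIII] Cor. 3.12 holds or fails at
any datum, or takes a side on any author; typed ≠ proved; computed ≠ proved. [claim: Mochizuki2012, status: disputed] for every IUT locution.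
[cite: Mochizuki2012, IUTchIII Cor. 3.12 p. 173–174, Prop. 3.9 (i)–(iii) p. 116–117; IUTchIV Thm. 1.10 Step (v) p. 27–29, Steps (viii)–(x) p. 30–32]
[cite: DupuyHilado2025, §3.3, Thm. 3.10.1]
-/

noncomputable section

open Set Function NumberField IsDedekindDomain

namespace Summit.ABC.IUTFork.Repair.RH.CellWeights

open Summit.ABC.IUTFork.Thm311 Summit.ABC.IUTFork.Thm311.Real Summit.ABC.IUTFork.Cor312 Summit.ABC.IUTFork.Cor312.Setting
  Summit.ABC.IUTFork.Cor312Vol Summit.ABC.IUTFork.Cor312Prov Literature.IUT.LogThetaLattice Literature.IUT.LogVolume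
  Literature.IUT.HodgeTheaters Literature.IUT.LogVolume.ThetaData Literature.NumberTheory.DiophantineGeometry.GenEll
  Summit.ABC.IUTFork.Repair.RH.SigmaLicence Summit.ABC.IUTFork.Repair.RH.SigmaStrataEq Summit.ABC.IUTFork.Repair.RH.SigmaMass
  Summit.ABC.IUTFork.Repair.RH.OffSigma Summit.ABC.IUTFork.Conditional

/-! ## §1. One packet and the bed: a certified `θ·j²` credit keeps AT LEAST `S(J) + θ·(S(n) − S(J))` -/

section Place

/-- **A CERTIFIED `θ·j²` CREDIT KEEPS AT LEAST `S(J) + θ·(S(n) − S(J))`.** One packet, `n` labels, place weight `h ≥ 0`, slice `J ≤ n`; a profile `ω` with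
`ω_i = 1` below the slice (`i+1 ≤ J`) and `θ·((i+1)²−1) ≤ ω_i·((i+1)²−1)` above it: `(S(J) + θ·(S(n) − S(J)))·h ≤ Σ_i ω_i((i+1)²−1)h` — the converse of
p485470 `placeSum_credit_le_of_quadratic`. [folklore] -/
theorem placeSum_credit_ge_of_quadratic {n J : ℕ} (hJ : J ≤ n) (ω : Fin n → ℝ) {θ h : ℝ} (hh : 0 ≤ h)
    (hbelow : ∀ i : Fin n, (i : ℕ) + 1 ≤ J → ω i = 1)
    (habove : ∀ i : Fin n, J < (i : ℕ) + 1 → θ * ((((i : ℕ) : ℝ) + 1) ^ 2 - 1) ≤ ω i * ((((i : ℕ) : ℝ) + 1) ^ 2 - 1)) :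
    ((J : ℝ) * (J - 1) * (2 * J + 5) / 6 +
        θ * ((n : ℝ) * (n - 1) * (2 * n + 5) / 6 - (J : ℝ) * (J - 1) * (2 * J + 5) / 6)) * h ≤
      ∑ i : Fin n, ω i * (((((i : ℕ) : ℝ) + 1) ^ 2 - 1) * h) := by
  have hterm : ∀ i : Fin n,
      (θ * ((((i : ℕ) : ℝ) + 1) ^ 2 - 1) + (1 - θ) * (if (i : ℕ) + 1 ≤ J then (((i : ℕ) : ℝ) + 1) ^ 2 - 1 else 0)) * h ≤
        ω i * (((((i : ℕ) : ℝ) + 1) ^ 2 - 1) * h) := by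
    intro i
    rw [← mul_assoc]
    refine mul_le_mul_of_nonneg_right ?_ hh
    by_cases hiJ : (i : ℕ) + 1 ≤ J
    · rw [if_pos hiJ, hbelow i hiJ]
      linarith
    · rw [if_neg hiJ, mul_zero, add_zero]
      exact habove i (by omega)
  refine le_trans (le_of_eq ?_) (Finset.sum_le_sum fun i _ => hterm i)
  rw [← Finset.sum_mul, Finset.sum_add_distrib, ← Finset.mul_sum, ← Finset.mul_sum, sum_fin_sqSubOne_initialSegment hJ, sum_fin_sqSubOne]
  ring

/-- **THE SUP BOUND, one packet**: if the per-place kept numerator is at most `Φ·S(n)`, then an `O(j)`-credit profile keeps `≤ Φ·S(n)·h` there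
(p485470 `placeSum_credit_le_of_linear` followed by the numerator bound). [folklore] -/
theorem placeSum_credit_le_sup_of_linear {n J : ℕ} (hJ : J ≤ n) (ω : Fin n → ℝ) (hω1 : ∀ i, ω i ≤ 1) {a b h Φ : ℝ}
    (ha : 0 ≤ a) (hb : 0 ≤ b) (hh : 0 ≤ h)
    (hlin : ∀ i : Fin n, J < (i : ℕ) + 1 → ω i * ((((i : ℕ) : ℝ) + 1) ^ 2 - 1) ≤ a * (((i : ℕ) : ℝ) + 1) + b)
    (hΦ : (J : ℝ) * (J - 1) * (2 * J + 5) / 6 + a * ((n : ℝ) * (n + 1) / 2) + b * n ≤ Φ * ((n : ℝ) * (n - 1) * (2 * n + 5) / 6)) :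
    ∑ i : Fin n, ω i * (((((i : ℕ) : ℝ) + 1) ^ 2 - 1) * h) ≤ Φ * ((n : ℝ) * (n - 1) * (2 * n + 5) / 6) * h :=
  (placeSum_credit_le_of_linear hJ ω hω1 ha hb hh hlin).trans (mul_le_mul_of_nonneg_right hΦ hh)

end Place

section Bed

variable {F : Type} [Field F] [NumberField F] (X : PilotData F) {logv : PadicLogs F} (hlog : LogvAnalytic logv)
  (M : Type) [Field M] [NumberField M]
  (archPk : ∀ (j : (thetaIndex X).Label) (vQ : (thetaIndex X).VQ), Set ((logShellsDH X logv).Packet j vQ))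
  (archSub : ∀ (j : (thetaIndex X).Label) (v : (thetaIndex X).V),
    Set ((logShellsDH X logv).Packet j ((thetaIndex X).over v)))
  (Ψ : ℤ → ∀ v : (thetaIndex X).V, v ∈ (thetaIndex X).Vbad → Set ((logShellsDH X logv).StarPacket v))
  (act : ℤ → ∀ v : (thetaIndex X).V, v ∈ (thetaIndex X).Vbad →
    (logShellsDH X logv).StarPacket v → Module.End ℚ ((logShellsDH X logv).StarPacket v))
  (Mmod : ℤ → ∀ j : (thetaIndex X).LabelStar, Set ((logShellsDH X logv).GlobalPacket j.1))
  (region : ℤ → ∀ j : (thetaIndex X).LabelStar, FinDivisor M → ∀ vQ : (thetaIndex X).VQ,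
    Set ((logShellsDH X logv).Packet j.1 vQ))
  (n : ℤ) {HT : Type} {LogLink : HT → HT → Type} {IsFull : ∀ {s t : HT}, LogLink s t → Prop}
  (lat : LGPGaussianLogThetaLattice LogLink IsFull)
  {Frd : Type} {IsoF : Frd → Frd → Type} {Ob : Frd → Type} {realify : Frd → Frd} {Strip : Type}
  {IsoS : Strip → Strip → Type} {Mv : ∀ v : (thetaIndex X).V, v ∈ (thetaIndex X).Vbad → Type}
  [∀ v h, Monoid (Mv v h)]
  (sig : GlobalLGPFrobenioidSignature (thetaIndex X).lstar (thetaIndex X).V (· ∈ (thetaIndex X).Vbad)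
    Frd IsoF Ob realify Strip IsoS Mv)
  (split : SplittingMonoids Mv) {ObΔ : Type} {N : ∀ v : (thetaIndex X).V, v ∈ (thetaIndex X).Vbad → Type}
  [∀ v h, Monoid (N v h)] (qData : QPilotData ObΔ N)
  (tq : ∀ (pp : Nat.Primes) (x : (thetaIndex X).Fibre (.inr pp)), haveI : Fact (pp : ℕ).Prime := ⟨pp.2⟩; kOf X pp.1 x)
  (t : ∀ (pp : Nat.Primes) (_ : Fin X.lstar) (x : (thetaIndex X).Fibre (.inr pp)),
    haveI : Fact (pp : ℕ).Prime := ⟨pp.2⟩; kOf X pp.1 x)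
  (htq0 : ∀ pp x, tq pp x ≠ 0)
  (htq1 : ∀ (pp : Nat.Primes) (x : (thetaIndex X).Fibre (.inr pp)),
    haveI : Fact (pp : ℕ).Prime := ⟨pp.2⟩; placeOf X pp.1 x ∉ X.S → ‖tq pp x‖ = 1)
  (ht0 : ∀ pp i x, t pp i x ≠ 0)
  (ht : ∀ (pp : Nat.Primes) (i : Fin X.lstar) (x : (thetaIndex X).Fibre (.inr pp)),
    haveI : Fact (pp : ℕ).Prime := ⟨pp.2⟩
    Real.log ‖t pp i x‖ = -(X.thetaPilot i (placeOf X pp.1 x)) * logNorm F (placeOf X pp.1 x) / localDegree F (placeOf X pp.1 x))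
  (htq : ∀ (pp : Nat.Primes) (x : (thetaIndex X).Fibre (.inr pp)),
    haveI : Fact (pp : ℕ).Prime := ⟨pp.2⟩
    Real.log ‖tq pp x‖ = -(X.qPilot (placeOf X pp.1 x)) * logNorm F (placeOf X pp.1 x) / localDegree F (placeOf X pp.1 x))

include ht0 ht htq in
/-- **A CERTIFIED `θ·j²` CREDIT KEEPS `K(ω) ≥ ((S(J) + θ·(S(l⋇) − S(J)))/S(l⋇))·M` AT THE BED** (realising ideles; uniform slice `J ≤ l⋇` and fraction `θ` at every
packet of non-zero place weight: `ω = 1` below the slice, `θ·((i+1)²−1) ≤ ω·((i+1)²−1)` above it). [claim: Mochizuki2012, status: disputed] -/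
theorem keptMass_settingPrVolSharp_ge_frac_mul_totalTrivialMass_of_quadraticCredit
    (ω : Fin (thetaIndex X).lstar × (thetaIndex X).VQ → ℝ) {J : ℕ} (hJ : J ≤ X.lstar) {θ : ℝ}
    (hbelow : ∀ (i : Fin (thetaIndex X).lstar) (vQ : (thetaIndex X).VQ), Sum.elim (fun _ : Unit => (0 : ℝ))
      (fun pp : Nat.Primes => (∑ v ∈ placesOver F pp, X.qPilot v * logNorm F v) / Module.finrank ℚ F) vQ ≠ 0 → (i : ℕ) + 1 ≤ J → ω (i, vQ) = 1)
    (habove : ∀ (i : Fin (thetaIndex X).lstar) (vQ : (thetaIndex X).VQ), Sum.elim (fun _ : Unit => (0 : ℝ))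
      (fun pp : Nat.Primes => (∑ v ∈ placesOver F pp, X.qPilot v * logNorm F v) / Module.finrank ℚ F) vQ ≠ 0 → J < (i : ℕ) + 1 →
        θ * ((((i : ℕ) : ℝ) + 1) ^ 2 - 1) ≤ ω (i, vQ) * ((((i : ℕ) : ℝ) + 1) ^ 2 - 1)) :
    ((J : ℝ) * (J - 1) * (2 * J + 5) / 6 +
          θ * ((X.lstar : ℝ) * (X.lstar - 1) * (2 * X.lstar + 5) / 6 - (J : ℝ) * (J - 1) * (2 * J + 5) / 6)) /
        ((X.lstar : ℝ) * (X.lstar - 1) * (2 * X.lstar + 5) / 6) *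
        totalTrivialMass (settingPrVolSharp X hlog M archPk archSub Ψ act Mmod region n lat sig split qData tq t htq0 htq1) ≤
      processionNormalized (fun i : Fin (thetaIndex X).lstar => ∑ᶠ vQ : (thetaIndex X).VQ,
        ω (i, vQ) * cellTrivialCost (settingPrVolSharp X hlog M archPk archSub Ψ act Mmod region n lat sig split qData tq t htq0 htq1) (i, vQ)) := by
  have hcost := cellTrivialCost_settingPrVolSharp_eq_sqSubOne_mul_placeWeight X hlog M archPk archSub Ψ act Mmod region n lat sig split qData tq t
    htq0 htq1 ht0 ht htq
  have hhfin := placeWeight_support_finite X hlog M archPk archSub Ψ act Mmod region n lat sig split qData tq t htq0 htq1 htq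
  have hsupp : ∀ i : Fin (thetaIndex X).lstar, (Function.support fun vQ : (thetaIndex X).VQ =>
      ω (i, vQ) * cellTrivialCost (settingPrVolSharp X hlog M archPk archSub Ψ act Mmod region n lat sig split qData tq t htq0 htq1) (i, vQ)).Finite :=
    fun i => hhfin.subset (Function.support_subset_iff'.2 fun vQ hvQ => by
      rw [hcost i vQ, Function.notMem_support.1 hvQ, mul_zero, mul_zero])
  -- Step 1: the place-sum lower bound `(C·Σᶠ h)/l⋇ ≤ K(ω)`
  have hK : ((J : ℝ) * (J - 1) * (2 * J + 5) / 6 +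
          θ * ((X.lstar : ℝ) * (X.lstar - 1) * (2 * X.lstar + 5) / 6 - (J : ℝ) * (J - 1) * (2 * J + 5) / 6)) *
        (∑ᶠ vQ : (thetaIndex X).VQ, Sum.elim (fun _ : Unit => (0 : ℝ))
          (fun pp : Nat.Primes => (∑ v ∈ placesOver F pp, X.qPilot v * logNorm F v) / Module.finrank ℚ F) vQ) / X.lstar ≤
      processionNormalized (fun i : Fin (thetaIndex X).lstar => ∑ᶠ vQ : (thetaIndex X).VQ,
        ω (i, vQ) * cellTrivialCost (settingPrVolSharp X hlog M archPk archSub Ψ act Mmod region n lat sig split qData tq t htq0 htq1) (i, vQ)) := by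
    unfold processionNormalized
    rw [sum_finsum_comm Finset.univ (fun (i : Fin (thetaIndex X).lstar) (vQ : (thetaIndex X).VQ) =>
        ω (i, vQ) * cellTrivialCost (settingPrVolSharp X hlog M archPk archSub Ψ act Mmod region n lat sig split qData tq t htq0 htq1) (i, vQ))
      fun i _ => hsupp i, mul_finsum]
    refine div_le_div_of_nonneg_right ?_ (Nat.cast_nonneg _)
    have hF : (Function.support fun vQ : (thetaIndex X).VQ => ∑ i : Fin (thetaIndex X).lstar,
        ω (i, vQ) * cellTrivialCost (settingPrVolSharp X hlog M archPk archSub Ψ act Mmod region n lat sig split qData tq t htq0 htq1) (i, vQ)).Finite :=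
      hhfin.subset (Function.support_subset_iff'.2 fun vQ hvQ => Finset.sum_eq_zero fun i _ => by
        rw [hcost i vQ, Function.notMem_support.1 hvQ, mul_zero, mul_zero])
    have hG : (Function.support fun vQ : (thetaIndex X).VQ =>
        ((J : ℝ) * (J - 1) * (2 * J + 5) / 6 +
            θ * ((X.lstar : ℝ) * (X.lstar - 1) * (2 * X.lstar + 5) / 6 - (J : ℝ) * (J - 1) * (2 * J + 5) / 6)) *
          Sum.elim (fun _ : Unit => (0 : ℝ))
            (fun pp : Nat.Primes => (∑ v ∈ placesOver F pp, X.qPilot v * logNorm F v) / Module.finrank ℚ F) vQ).Finite :=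
      hhfin.subset (Function.support_subset_iff'.2 fun vQ hvQ => by rw [Function.notMem_support.1 hvQ, mul_zero])
    refine finsum_le_finsum' hG hF fun vQ => ?_
    simp only [hcost]
    by_cases h0 : Sum.elim (fun _ : Unit => (0 : ℝ))
        (fun pp : Nat.Primes => (∑ v ∈ placesOver F pp, X.qPilot v * logNorm F v) / Module.finrank ℚ F) vQ = 0
    · simp only [h0, mul_zero, Finset.sum_const_zero, le_refl]
    · exact placeSum_credit_ge_of_quadratic (hJ.trans_eq rfl) (fun i => ω (i, vQ)) (placeWeight_nonneg X vQ)
        (fun i hi => hbelow i vQ h0 hi) (fun i hi => habove i vQ h0 hi)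
  -- Step 2: multiply out `M = (S(l⋇)/l⋇)·Σᶠ h`
  rw [totalTrivialMass_settingPrVolSharp_eq_sqSubOneSum_mul_finsum_placeWeight X hlog M archPk archSub Ψ act Mmod region n lat sig split qData tq t
    htq0 htq1 ht0 ht htq]
  have h2 : (2 : ℝ) ≤ X.lstar := by exact_mod_cast X.two_le_lstar
  have hl0 : (X.lstar : ℝ) ≠ 0 := by positivity
  have hl1 : (X.lstar : ℝ) - 1 ≠ 0 := (show (0 : ℝ) < X.lstar - 1 by linarith).ne'
  have hl5 : 2 * (X.lstar : ℝ) + 5 ≠ 0 := by positivity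
  refine le_trans (le_of_eq ?_) hK
  field_simp

include ht0 ht htq in
/-- **THE SUP-FORM OF SCREEN RULE S1 AT THE BED**: PLACE-DEPENDENT slices `J(v_ℚ) ≤ l⋇` and `O(j)` coefficients `a(v_ℚ), b(v_ℚ) ≥ 0`; if at every packet the per-place
kept numerator is at most `Φ·S(l⋇)`, then `K(ω) ≤ Φ·M` (p485470's per-packet bound, then `Σᶠ Φ·S(l⋇)·h = Φ·S(l⋇)·Σᶠ h`). The testers' `Φ = max_v Φ_v`. [claim: Mochizuki2012, status: disputed] -/
theorem keptMass_settingPrVolSharp_le_sup_mul_totalTrivialMass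
    (ω : Fin (thetaIndex X).lstar × (thetaIndex X).VQ → ℝ) (hω1 : ∀ c, ω c ≤ 1)
    {J : (thetaIndex X).VQ → ℕ} (hJ : ∀ vQ, J vQ ≤ X.lstar) {a b : (thetaIndex X).VQ → ℝ} (ha : ∀ vQ, 0 ≤ a vQ) (hb : ∀ vQ, 0 ≤ b vQ)
    (hlin : ∀ (i : Fin (thetaIndex X).lstar) (vQ : (thetaIndex X).VQ), J vQ < (i : ℕ) + 1 →
      ω (i, vQ) * ((((i : ℕ) : ℝ) + 1) ^ 2 - 1) ≤ a vQ * (((i : ℕ) : ℝ) + 1) + b vQ) {Φ : ℝ}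
    (hΦ : ∀ vQ : (thetaIndex X).VQ, (J vQ : ℝ) * (J vQ - 1) * (2 * J vQ + 5) / 6 + a vQ * ((X.lstar : ℝ) * (X.lstar + 1) / 2) + b vQ * X.lstar ≤
      Φ * ((X.lstar : ℝ) * (X.lstar - 1) * (2 * X.lstar + 5) / 6)) :
    processionNormalized (fun i : Fin (thetaIndex X).lstar => ∑ᶠ vQ : (thetaIndex X).VQ,
        ω (i, vQ) * cellTrivialCost (settingPrVolSharp X hlog M archPk archSub Ψ act Mmod region n lat sig split qData tq t htq0 htq1) (i, vQ)) ≤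
      Φ * totalTrivialMass (settingPrVolSharp X hlog M archPk archSub Ψ act Mmod region n lat sig split qData tq t htq0 htq1) := by
  have h := keptMass_settingPrVolSharp_le_of_linearCredit X hlog M archPk archSub Ψ act Mmod region n lat sig split qData tq t htq0 htq1 ht0 ht htq
    ω hω1 hJ ha hb hlin
  have hhfin := placeWeight_support_finite X hlog M archPk archSub Ψ act Mmod region n lat sig split qData tq t htq0 htq1 htq
  refine h.trans ?_
  rw [totalTrivialMass_settingPrVolSharp_eq_sqSubOneSum_mul_finsum_placeWeight X hlog M archPk archSub Ψ act Mmod region n lat sig split qData tq t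
    htq0 htq1 ht0 ht htq]
  have hRHS : Φ * ((X.lstar : ℝ) * (X.lstar - 1) * (2 * X.lstar + 5) / 6 *
        (∑ᶠ vQ : (thetaIndex X).VQ, Sum.elim (fun _ : Unit => (0 : ℝ))
          (fun pp : Nat.Primes => (∑ v ∈ placesOver F pp, X.qPilot v * logNorm F v) / Module.finrank ℚ F) vQ) / X.lstar) =
      (∑ᶠ vQ : (thetaIndex X).VQ, Φ * ((X.lstar : ℝ) * (X.lstar - 1) * (2 * X.lstar + 5) / 6) *
        Sum.elim (fun _ : Unit => (0 : ℝ))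
          (fun pp : Nat.Primes => (∑ v ∈ placesOver F pp, X.qPilot v * logNorm F v) / Module.finrank ℚ F) vQ) / X.lstar := by
    rw [← mul_finsum]
    ring
  rw [hRHS]
  refine div_le_div_of_nonneg_right ?_ (Nat.cast_nonneg _)
  refine finsum_le_finsum'
    (hhfin.subset (Function.support_subset_iff'.2 fun vQ hvQ => by rw [Function.notMem_support.1 hvQ, mul_zero]))
    (hhfin.subset (Function.support_subset_iff'.2 fun vQ hvQ => by rw [Function.notMem_support.1 hvQ, mul_zero])) fun vQ => ?_
  exact mul_le_mul_of_nonneg_right (hΦ vQ) (placeWeight_nonneg X vQ)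

end Bed

/-! ## §2. At a genuine Θ-volume datum with the chosen ideles -/

section Datum

/-- **A CERTIFIED `θ·j²` CREDIT DISCHARGES THE WEIGHTED [MU-C] AT `μ₀ = (S(J) + θ·(S(l⋇) − S(J)))/S(l⋇)`.** At the datum's bed with the chosen ideles, a weight `ω` with
licence below the uniform slice `J ≤ l⋇` (`ω = 1`) and a certified fraction `θ` of each cell's `(j²−1)`-demand above it, at every packet of non-zero place weight, gives
`OffSigmaTolerance (1 − μ₀) A T (weightedTrivialMass … ω)` for every `A ≥ 0` — the hypothesis abc-iut-rh2-q2-eq's partial-credit / weighted doors (p484504 / p480491)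
and the EXP endpoints consume, with exponent `1/μ₀` (`θ = 0`: p483646's depth certificate; `θ = 1`: `μ₀ = 1`). Whether any object CERTIFIES such a `θ > 0` at the
top labels is the round-3 question; nothing is asserted. [claim: Mochizuki2012, status: disputed] -/
theorem offSigmaTolerance_weightedTrivialMass_of_quadraticCredit_chosen {P : NFPoint} {l : ℕ} (T : Cor22.ThetaVolumeDatumAt P l) :
    letI := T.instFieldF; letI := T.instNumberFieldF; letI := T.instAlgebraF; letI := T.instFieldK; letI := T.instNumberFieldK; letI := T.instAlgebraK;
        letI := T.instFieldFbar; letI := T.instAlgebraFbar; letI := T.instAlgebraKFbar; letI := T.instIsElliptic;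
    ∀ (M : Type) [Field M] [NumberField M]
      (archPk : ∀ (j : (thetaIndex (pilotDataOfK T.D T.K)).Label) (vQ : (thetaIndex (pilotDataOfK T.D T.K)).VQ), Set ((logShellsDH (pilotDataOfK T.D T.K) (analyticLogv T.K)).Packet j vQ))
      (archSub : ∀ (j : (thetaIndex (pilotDataOfK T.D T.K)).Label) (v : (thetaIndex (pilotDataOfK T.D T.K)).V),
        Set ((logShellsDH (pilotDataOfK T.D T.K) (analyticLogv T.K)).Packet j ((thetaIndex (pilotDataOfK T.D T.K)).over v)))
      (Ψ : ℤ → ∀ v : (thetaIndex (pilotDataOfK T.D T.K)).V, v ∈ (thetaIndex (pilotDataOfK T.D T.K)).Vbad → Set ((logShellsDH (pilotDataOfK T.D T.K) (analyticLogv T.K)).StarPacket v))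
      (act : ℤ → ∀ v : (thetaIndex (pilotDataOfK T.D T.K)).V, v ∈ (thetaIndex (pilotDataOfK T.D T.K)).Vbad →
        (logShellsDH (pilotDataOfK T.D T.K) (analyticLogv T.K)).StarPacket v → Module.End ℚ ((logShellsDH (pilotDataOfK T.D T.K) (analyticLogv T.K)).StarPacket v))
      (Mmod : ℤ → ∀ j : (thetaIndex (pilotDataOfK T.D T.K)).LabelStar, Set ((logShellsDH (pilotDataOfK T.D T.K) (analyticLogv T.K)).GlobalPacket j.1))
      (region : ℤ → ∀ j : (thetaIndex (pilotDataOfK T.D T.K)).LabelStar, FinDivisor M →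
        ∀ vQ : (thetaIndex (pilotDataOfK T.D T.K)).VQ, Set ((logShellsDH (pilotDataOfK T.D T.K) (analyticLogv T.K)).Packet j.1 vQ))
      (n : ℤ) {HT : Type} {LogLink : HT → HT → Type} {IsFull : ∀ {s t : HT}, LogLink s t → Prop} (lat : LGPGaussianLogThetaLattice LogLink IsFull)
      {Frd : Type} {IsoF : Frd → Frd → Type} {Ob : Frd → Type} {realify : Frd → Frd} {Strip : Type} {IsoS : Strip → Strip → Type}
      {Mv : ∀ v : (thetaIndex (pilotDataOfK T.D T.K)).V, v ∈ (thetaIndex (pilotDataOfK T.D T.K)).Vbad → Type} [∀ v h, Monoid (Mv v h)]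
      (sig : GlobalLGPFrobenioidSignature (thetaIndex (pilotDataOfK T.D T.K)).lstar (thetaIndex (pilotDataOfK T.D T.K)).V
        (· ∈ (thetaIndex (pilotDataOfK T.D T.K)).Vbad) Frd IsoF Ob realify Strip IsoS Mv)
      (split : SplittingMonoids Mv) {ObΔ : Type} {N : ∀ v : (thetaIndex (pilotDataOfK T.D T.K)).V, v ∈ (thetaIndex (pilotDataOfK T.D T.K)).Vbad → Type}
      [∀ v h, Monoid (N v h)] (qData : QPilotData ObΔ N)
      (ω : Fin (thetaIndex (pilotDataOfK T.D T.K)).lstar × (thetaIndex (pilotDataOfK T.D T.K)).VQ → ℝ)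
      (J : ℕ) (_ : J ≤ (pilotDataOfK T.D T.K).lstar) (θ : ℝ)
      (_ : ∀ (i : Fin (thetaIndex (pilotDataOfK T.D T.K)).lstar) (vQ : (thetaIndex (pilotDataOfK T.D T.K)).VQ), Sum.elim (fun _ : Unit => (0 : ℝ))
        (fun pp : Nat.Primes => (∑ v ∈ placesOver T.K pp, (pilotDataOfK T.D T.K).qPilot v * logNorm T.K v) / Module.finrank ℚ T.K) vQ ≠ 0 →
          (i : ℕ) + 1 ≤ J → ω (i, vQ) = 1)
      (_ : ∀ (i : Fin (thetaIndex (pilotDataOfK T.D T.K)).lstar) (vQ : (thetaIndex (pilotDataOfK T.D T.K)).VQ), Sum.elim (fun _ : Unit => (0 : ℝ))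
        (fun pp : Nat.Primes => (∑ v ∈ placesOver T.K pp, (pilotDataOfK T.D T.K).qPilot v * logNorm T.K v) / Module.finrank ℚ T.K) vQ ≠ 0 →
          J < (i : ℕ) + 1 → θ * ((((i : ℕ) : ℝ) + 1) ^ 2 - 1) ≤ ω (i, vQ) * ((((i : ℕ) : ℝ) + 1) ^ 2 - 1))
      (A : ℝ), 0 ≤ A →
      OffSigmaTolerance
        (1 - ((J : ℝ) * (J - 1) * (2 * J + 5) / 6 +
              θ * ((((pilotDataOfK T.D T.K).lstar : ℝ) * ((pilotDataOfK T.D T.K).lstar - 1) * (2 * (pilotDataOfK T.D T.K).lstar + 5) / 6) -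
                (J : ℝ) * (J - 1) * (2 * J + 5) / 6)) /
            (((pilotDataOfK T.D T.K).lstar : ℝ) * ((pilotDataOfK T.D T.K).lstar - 1) * (2 * (pilotDataOfK T.D T.K).lstar + 5) / 6))
        A T (weightedTrivialMass (settingPrVolSharp (pilotDataOfK T.D T.K) (logvAnalytic_analyticLogv (F := T.K)) M archPk archSub Ψ act Mmod region n lat
            sig split qData (exists_realising_qIdeles_pilotDataOfK T.D).choose (exists_realising_thetaIdeles_pilotDataOfK T.D).choose
            (exists_realising_qIdeles_pilotDataOfK T.D).choose_spec.1 (exists_realising_qIdeles_pilotDataOfK T.D).choose_spec.2.1) ω) := by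
  intro M _ _ archPk archSub Ψ act Mmod region n HT LogLink IsFull lat Frd IsoF Ob realify Strip IsoS Mv _ sig split ObΔ N _ qData ω J hJ θ hbelow habove A hA
  letI := T.instFieldF; letI := T.instNumberFieldF; letI := T.instAlgebraF; letI := T.instFieldK; letI := T.instNumberFieldK
  letI := T.instAlgebraK; letI := T.instFieldFbar; letI := T.instAlgebraFbar; letI := T.instAlgebraKFbar; letI := T.instIsElliptic
  have H := bridgeHyps_settingPrVolSharp_of_ideles (pilotDataOfK T.D T.K) (logvAnalytic_analyticLogv (F := T.K)) M archPk archSub Ψ act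
    Mmod region n lat sig split qData (exists_realising_thetaIdeles_pilotDataOfK T.D).choose (exists_realising_qIdeles_pilotDataOfK T.D).choose
    (exists_realising_thetaIdeles_pilotDataOfK T.D).choose_spec.1 (exists_realising_thetaIdeles_pilotDataOfK T.D).choose_spec.2.1
    (exists_realising_qIdeles_pilotDataOfK T.D).choose_spec.1 (exists_realising_qIdeles_pilotDataOfK T.D).choose_spec.2.1
  have hg := totalTrivialMass_chosen_eq_gap T M archPk archSub Ψ act Mmod region n lat sig split qData
  have hkept := keptMass_settingPrVolSharp_ge_frac_mul_totalTrivialMass_of_quadraticCredit (pilotDataOfK T.D T.K) (logvAnalytic_analyticLogv (F := T.K))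
    M archPk archSub Ψ act Mmod region n lat sig split qData (exists_realising_qIdeles_pilotDataOfK T.D).choose
    (exists_realising_thetaIdeles_pilotDataOfK T.D).choose (exists_realising_qIdeles_pilotDataOfK T.D).choose_spec.1
    (exists_realising_qIdeles_pilotDataOfK T.D).choose_spec.2.1 (exists_realising_thetaIdeles_pilotDataOfK T.D).choose_spec.1
    (exists_realising_thetaIdeles_pilotDataOfK T.D).choose_spec.2.2 (exists_realising_qIdeles_pilotDataOfK T.D).choose_spec.2.2 ω hJ hbelow habove
  rw [← weightedTrivialMass_compl_eq] at hkept
  have hsplit := weightedTrivialMass_eq_totalTrivialMass_sub H ω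
  rw [hg] at hkept hsplit
  unfold OffSigmaTolerance
  rw [hsplit]
  linarith

/-- **THE SUP-FORM OF S1 AT THE DATUM (NECESSITY, place-dependent slices)**: with per-packet slices `J(v_ℚ)`, `O(j)` coefficients `a(v_ℚ), b(v_ℚ) ≥ 0` and a uniform
bound `Φ` on the per-place kept numerators (`S(J) + a·T(l⋇) + b·l⋇ ≤ Φ·S(l⋇)` at every packet), the weighted [MU-C] `OffSigmaTolerance (1 − μ₀) A T (weightedTrivialMass … ω)`
FORCES `μ₀·T.gap ≤ Φ·T.gap + A` — the form the rh4 testers apply with `Φ = max` over a datum's bad places of `f_w³ + (3/2)(a_w/J_w)f_w·(1+o(1))`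
(`f_w = j₀(w)/l⋇` from `plan/rescue/R-H/SLICE.md`). [claim: Mochizuki2012, status: disputed] -/
theorem mu_mul_gap_le_sup_of_offSigmaTolerance_weightedTrivialMass_chosen {P : NFPoint} {l : ℕ} (T : Cor22.ThetaVolumeDatumAt P l) :
    letI := T.instFieldF; letI := T.instNumberFieldF; letI := T.instAlgebraF; letI := T.instFieldK; letI := T.instNumberFieldK; letI := T.instAlgebraK;
        letI := T.instFieldFbar; letI := T.instAlgebraFbar; letI := T.instAlgebraKFbar; letI := T.instIsElliptic;
    ∀ (M : Type) [Field M] [NumberField M]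
      (archPk : ∀ (j : (thetaIndex (pilotDataOfK T.D T.K)).Label) (vQ : (thetaIndex (pilotDataOfK T.D T.K)).VQ), Set ((logShellsDH (pilotDataOfK T.D T.K) (analyticLogv T.K)).Packet j vQ))
      (archSub : ∀ (j : (thetaIndex (pilotDataOfK T.D T.K)).Label) (v : (thetaIndex (pilotDataOfK T.D T.K)).V),
        Set ((logShellsDH (pilotDataOfK T.D T.K) (analyticLogv T.K)).Packet j ((thetaIndex (pilotDataOfK T.D T.K)).over v)))
      (Ψ : ℤ → ∀ v : (thetaIndex (pilotDataOfK T.D T.K)).V, v ∈ (thetaIndex (pilotDataOfK T.D T.K)).Vbad → Set ((logShellsDH (pilotDataOfK T.D T.K) (analyticLogv T.K)).StarPacket v))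
      (act : ℤ → ∀ v : (thetaIndex (pilotDataOfK T.D T.K)).V, v ∈ (thetaIndex (pilotDataOfK T.D T.K)).Vbad →
        (logShellsDH (pilotDataOfK T.D T.K) (analyticLogv T.K)).StarPacket v → Module.End ℚ ((logShellsDH (pilotDataOfK T.D T.K) (analyticLogv T.K)).StarPacket v))
      (Mmod : ℤ → ∀ j : (thetaIndex (pilotDataOfK T.D T.K)).LabelStar, Set ((logShellsDH (pilotDataOfK T.D T.K) (analyticLogv T.K)).GlobalPacket j.1))
      (region : ℤ → ∀ j : (thetaIndex (pilotDataOfK T.D T.K)).LabelStar, FinDivisor M →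
        ∀ vQ : (thetaIndex (pilotDataOfK T.D T.K)).VQ, Set ((logShellsDH (pilotDataOfK T.D T.K) (analyticLogv T.K)).Packet j.1 vQ))
      (n : ℤ) {HT : Type} {LogLink : HT → HT → Type} {IsFull : ∀ {s t : HT}, LogLink s t → Prop} (lat : LGPGaussianLogThetaLattice LogLink IsFull)
      {Frd : Type} {IsoF : Frd → Frd → Type} {Ob : Frd → Type} {realify : Frd → Frd} {Strip : Type} {IsoS : Strip → Strip → Type}
      {Mv : ∀ v : (thetaIndex (pilotDataOfK T.D T.K)).V, v ∈ (thetaIndex (pilotDataOfK T.D T.K)).Vbad → Type} [∀ v h, Monoid (Mv v h)]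
      (sig : GlobalLGPFrobenioidSignature (thetaIndex (pilotDataOfK T.D T.K)).lstar (thetaIndex (pilotDataOfK T.D T.K)).V
        (· ∈ (thetaIndex (pilotDataOfK T.D T.K)).Vbad) Frd IsoF Ob realify Strip IsoS Mv)
      (split : SplittingMonoids Mv) {ObΔ : Type} {N : ∀ v : (thetaIndex (pilotDataOfK T.D T.K)).V, v ∈ (thetaIndex (pilotDataOfK T.D T.K)).Vbad → Type}
      [∀ v h, Monoid (N v h)] (qData : QPilotData ObΔ N)
      (ω : Fin (thetaIndex (pilotDataOfK T.D T.K)).lstar × (thetaIndex (pilotDataOfK T.D T.K)).VQ → ℝ) (_ : ∀ c, ω c ≤ 1)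
      (J : (thetaIndex (pilotDataOfK T.D T.K)).VQ → ℕ) (_ : ∀ vQ, J vQ ≤ (pilotDataOfK T.D T.K).lstar)
      (a b : (thetaIndex (pilotDataOfK T.D T.K)).VQ → ℝ) (_ : ∀ vQ, 0 ≤ a vQ) (_ : ∀ vQ, 0 ≤ b vQ)
      (_ : ∀ (i : Fin (thetaIndex (pilotDataOfK T.D T.K)).lstar) (vQ : (thetaIndex (pilotDataOfK T.D T.K)).VQ), J vQ < (i : ℕ) + 1 →
        ω (i, vQ) * ((((i : ℕ) : ℝ) + 1) ^ 2 - 1) ≤ a vQ * (((i : ℕ) : ℝ) + 1) + b vQ)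
      (Φ : ℝ) (_ : ∀ vQ : (thetaIndex (pilotDataOfK T.D T.K)).VQ,
        (J vQ : ℝ) * (J vQ - 1) * (2 * J vQ + 5) / 6 + a vQ * (((pilotDataOfK T.D T.K).lstar : ℝ) * ((pilotDataOfK T.D T.K).lstar + 1) / 2) +
            b vQ * (pilotDataOfK T.D T.K).lstar ≤
          Φ * ((((pilotDataOfK T.D T.K).lstar : ℝ) * ((pilotDataOfK T.D T.K).lstar - 1) * (2 * (pilotDataOfK T.D T.K).lstar + 5) / 6)))
      (μ₀ A : ℝ), OffSigmaTolerance (1 - μ₀) A T (weightedTrivialMass (settingPrVolSharp (pilotDataOfK T.D T.K) (logvAnalytic_analyticLogv (F := T.K)) M archPk archSub Ψ act Mmod region n lat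
            sig split qData (exists_realising_qIdeles_pilotDataOfK T.D).choose (exists_realising_thetaIdeles_pilotDataOfK T.D).choose
            (exists_realising_qIdeles_pilotDataOfK T.D).choose_spec.1 (exists_realising_qIdeles_pilotDataOfK T.D).choose_spec.2.1) ω) → μ₀ * T.gap ≤ Φ * T.gap + A := by
  intro M _ _ archPk archSub Ψ act Mmod region n HT LogLink IsFull lat Frd IsoF Ob realify Strip IsoS Mv _ sig split ObΔ N _ qData ω hω1 J hJ a b ha hb
    hlin Φ hΦ μ₀ A hMU
  letI := T.instFieldF; letI := T.instNumberFieldF; letI := T.instAlgebraF; letI := T.instFieldK; letI := T.instNumberFieldK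
  letI := T.instAlgebraK; letI := T.instFieldFbar; letI := T.instAlgebraFbar; letI := T.instAlgebraKFbar; letI := T.instIsElliptic
  have H := bridgeHyps_settingPrVolSharp_of_ideles (pilotDataOfK T.D T.K) (logvAnalytic_analyticLogv (F := T.K)) M archPk archSub Ψ act
    Mmod region n lat sig split qData (exists_realising_thetaIdeles_pilotDataOfK T.D).choose (exists_realising_qIdeles_pilotDataOfK T.D).choose
    (exists_realising_thetaIdeles_pilotDataOfK T.D).choose_spec.1 (exists_realising_thetaIdeles_pilotDataOfK T.D).choose_spec.2.1
    (exists_realising_qIdeles_pilotDataOfK T.D).choose_spec.1 (exists_realising_qIdeles_pilotDataOfK T.D).choose_spec.2.1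
  have hg := totalTrivialMass_chosen_eq_gap T M archPk archSub Ψ act Mmod region n lat sig split qData
  have hkept := keptMass_settingPrVolSharp_le_sup_mul_totalTrivialMass (pilotDataOfK T.D T.K) (logvAnalytic_analyticLogv (F := T.K))
    M archPk archSub Ψ act Mmod region n lat sig split qData (exists_realising_qIdeles_pilotDataOfK T.D).choose
    (exists_realising_thetaIdeles_pilotDataOfK T.D).choose (exists_realising_qIdeles_pilotDataOfK T.D).choose_spec.1
    (exists_realising_qIdeles_pilotDataOfK T.D).choose_spec.2.1 (exists_realising_thetaIdeles_pilotDataOfK T.D).choose_spec.1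
    (exists_realising_thetaIdeles_pilotDataOfK T.D).choose_spec.2.2 (exists_realising_qIdeles_pilotDataOfK T.D).choose_spec.2.2 ω hω1 hJ ha hb hlin hΦ
  rw [← weightedTrivialMass_compl_eq] at hkept
  have hsplit := weightedTrivialMass_eq_totalTrivialMass_sub H ω
  rw [hg] at hkept hsplit
  unfold OffSigmaTolerance at hMU
  rw [hsplit] at hMU
  linarith

end Datum

end Summit.ABC.IUTFork.Repair.RH.CellWeights

end
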